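import Summits.ABC.ABC.Theorems.SoloBlindCycloRad
import HarnessLib

/-!
# Thresholds are free: `abc ⟺ abc on {ω(abc) ≥ k, min(a,b) ≥ M, a and c perfect 2^(k+1)-th powers}` (solo-ABC-blind, generation 10)

For EVERY `k` and `M` the abc conjecture is equivalent to its restriction to the abc triples
`(a, b, c)` which simultaneously have

* at least `k` distinct prime factors, `k ≤ #(a·b·c).primeFactors`;
* both summands large, `M ≤ a` and `M ≤ b`;
* perfect-power ends, `a = x^(2^(k+1))` and `c = z^(2^(k+1))`.

(`abc_iff_abcThresholds`; the one-parameter slices are `abc_iff_abcCardGe` and `abc_iff_abcMinGe`.)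

Mechanism.  For coprime `0 < x < z` the number `z^(2^(i+1)) − x^(2^(i+1))` has at least `i`
distinct prime factors (`le_card_primeFactors_pow_sub_pow`): the factor
`z^(2^j) + x^(2^j) = s² + t²` (coprime `s, t`) picked up at each squaring is `≡ 1, 2 (mod 4)`, hence
has an odd prime factor, and an odd prime dividing `s² + t²` does not divide `s² − t²`.  So the
self-map `(u, v) ↦ (u^n, v^n − u^n, v^n)`, `n = 2^(k+1)`, of `SoloBlindCycloRad` lands inside the
restricted family as soon as `u ≥ M`; the transport `CycloRad`-type bound ⟹ abc of that file is
re-run for pairs `u ≥ M` only, evaluating at `(a, c)` when `a ≥ M`, at `(b, c)` when `b ≥ M`, and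
the triples with `a, b < M` have `c < 2M`.

For the wall: the first open case of abc (`ω(abc) = 3`, supports `{2, p, q}`), the `a = 1` shapes and
every bounded range of `min(a, b)` are NOT load-bearing — a proof may assume `ω(abc) ≥ k`, `min(a,b) ≥ M`
and `2^(k+1)`-th-power ends for any fixed `k, M` it likes, at the cost of constants only (the
exponent bookkeeping is that of `SoloBlindCycloRad`: `ε ↦ ε/n ↦ 1/(1+ε)`).  LOWER thresholds on the
number of primes, on the size of the smaller summand and on the power structure of the ends are free;
an UPPER threshold is not (abc on bounded `ω` is a theorem, `SoloBlindTwoPrimes`/`SoloBlindOmegaFree`).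
-/

noncomputable section

open UniqueFactorizationMonoid Finset

namespace Summit.ABC.ABC.Theorems

open Literature.NumberTheory.DiophantineGeometry

/-! ### Counting prime factors of `z^(2^j) − x^(2^j)` -/

/-- A sum of two coprime squares `s² + t²` with `s ≥ 2` has an odd prime factor
(it is `≡ 1` or `2 (mod 4)` and `> 2`). [folklore] -/
theorem exists_odd_prime_dvd_sq_add_sq {s t : ℕ} (hs : 2 ≤ s) (hcop : Nat.Coprime s t) :
    ∃ p : ℕ, p.Prime ∧ p ≠ 2 ∧ p ∣ s ^ 2 + t ^ 2 := by
  by_contra hne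
  push Not at hne
  have hB0 : s ^ 2 + t ^ 2 ≠ 0 := by positivity
  obtain ⟨e, hpow⟩ : ∃ e : ℕ, s ^ 2 + t ^ 2 = 2 ^ e :=
    ⟨_, Nat.eq_prime_pow_of_unique_prime_dvd hB0 (fun {d} hd hdvd => by
      by_contra h
      exact hne d hd h hdvd)⟩
  have h4 : 4 ∣ s ^ 2 + t ^ 2 := by
    have h2e : 2 ≤ e := by
      by_contra h
      push Not at h
      have h1 : 2 ^ e ≤ 2 ^ 1 := Nat.pow_le_pow_right (by norm_num) (by omega)
      nlinarith [hpow, h1]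
    rw [hpow, show (4 : ℕ) = 2 ^ 2 by norm_num]
    exact Nat.pow_dvd_pow 2 h2e
  rcases Nat.even_or_odd s with ⟨m, hm⟩ | ⟨m, hm⟩ <;>
    rcases Nat.even_or_odd t with ⟨l, hl⟩ | ⟨l, hl⟩
  · have h2s : 2 ∣ s := ⟨m, by omega⟩
    have h2t : 2 ∣ t := ⟨l, by omega⟩
    have := Nat.Coprime.eq_one_of_dvd (Nat.Coprime.coprime_dvd_left h2s hcop) h2t
    omega
  · subst hm hl
    have : (m + m) ^ 2 + (2 * l + 1) ^ 2 = 4 * (m * m + l * l + l) + 1 := by ring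
    omega
  · subst hm hl
    have : (2 * m + 1) ^ 2 + (l + l) ^ 2 = 4 * (m * m + m + l * l) + 1 := by ring
    omega
  · subst hm hl
    have : (2 * m + 1) ^ 2 + (2 * l + 1) ^ 2 = 4 * (m * m + m + l * l + l) + 2 := by ring
    omega

/-- An odd prime dividing `s² + t²` (`s, t` coprime, `t ≤ s`) does not divide `s² − t²`. [folklore] -/
theorem not_dvd_sq_sub_sq_of_dvd_sq_add_sq {s t p : ℕ} (hp : p.Prime) (hp2 : p ≠ 2)
    (hcop : Nat.Coprime s t) (hts : t ≤ s) (hB : p ∣ s ^ 2 + t ^ 2) : ¬ p ∣ s ^ 2 - t ^ 2 := by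
  intro hA
  have ht2 : t ^ 2 ≤ s ^ 2 := Nat.pow_le_pow_left hts 2
  have h2s : p ∣ 2 * s ^ 2 := by
    have : 2 * s ^ 2 = (s ^ 2 + t ^ 2) + (s ^ 2 - t ^ 2) := by omega
    rw [this]; exact dvd_add hB hA
  have h2t : p ∣ 2 * t ^ 2 := by
    have : s ^ 2 + t ^ 2 = (s ^ 2 - t ^ 2) + 2 * t ^ 2 := by omega
    have hB' := hB
    rw [this] at hB'
    exact (Nat.dvd_add_right hA).mp hB'
  have hp2' : ¬ p ∣ 2 := fun h => hp2 ((Nat.prime_dvd_prime_iff_eq hp Nat.prime_two).mp h)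
  have hs : p ∣ s := by
    rcases (Nat.Prime.dvd_mul hp).mp h2s with h | h
    · exact absurd h hp2'
    · exact hp.dvd_of_dvd_pow h
  have ht : p ∣ t := by
    rcases (Nat.Prime.dvd_mul hp).mp h2t with h | h
    · exact absurd h hp2'
    · exact hp.dvd_of_dvd_pow h
  have := Nat.Coprime.eq_one_of_dvd (Nat.Coprime.coprime_dvd_left hs hcop) ht
  have := hp.one_lt
  omega

/-- One squaring step gains a prime: `#pf(s² − t²) < #pf((s² + t²)(s² − t²))` for coprime `t < s`,
`s ≥ 2`. [folklore] -/
theorem card_primeFactors_lt_of_sq {s t : ℕ} (hs : 2 ≤ s) (hts : t < s) (hcop : Nat.Coprime s t) :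
    (s ^ 2 - t ^ 2).primeFactors.card < ((s ^ 2 + t ^ 2) * (s ^ 2 - t ^ 2)).primeFactors.card := by
  obtain ⟨p, hp, hp2, hpB⟩ := exists_odd_prime_dvd_sq_add_sq hs hcop
  have hA0 : s ^ 2 - t ^ 2 ≠ 0 := by
    have : t ^ 2 < s ^ 2 := Nat.pow_lt_pow_left hts (by norm_num)
    omega
  have hB0 : s ^ 2 + t ^ 2 ≠ 0 := by positivity
  apply Finset.card_lt_card
  rw [Nat.primeFactors_mul hB0 hA0, Finset.ssubset_iff_of_subset Finset.subset_union_right]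
  refine ⟨p, Finset.mem_union_left _ (Nat.mem_primeFactors.mpr ⟨hp, hpB, hB0⟩), fun h => ?_⟩
  exact not_dvd_sq_sub_sq_of_dvd_sq_add_sq hp hp2 hcop hts.le hpB (Nat.dvd_of_mem_primeFactors h)

/-- **`z^(2^(i+1)) − x^(2^(i+1))` has at least `i` distinct prime factors** for coprime
`0 < x < z`. [folklore] -/
theorem le_card_primeFactors_pow_sub_pow {x z : ℕ} (hx : 0 < x) (hxz : x < z)
    (hcop : Nat.Coprime x z) (i : ℕ) :
    i ≤ (z ^ 2 ^ (i + 1) - x ^ 2 ^ (i + 1)).primeFactors.card := by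
  induction i with
  | zero => exact Nat.zero_le _
  | succ i ih =>
    have h2i : 2 ^ i ≠ 0 := by positivity
    have hs : 2 ≤ z ^ 2 ^ i := le_trans (by omega) (Nat.le_self_pow h2i z)
    have hts : x ^ 2 ^ i < z ^ 2 ^ i := Nat.pow_lt_pow_left hxz h2i
    have hco : Nat.Coprime (z ^ 2 ^ i) (x ^ 2 ^ i) := Nat.Coprime.pow _ _ hcop.symm
    have hz1 : z ^ 2 ^ (i + 1) = (z ^ 2 ^ i) ^ 2 := by rw [pow_succ, pow_mul]
    have hx1 : x ^ 2 ^ (i + 1) = (x ^ 2 ^ i) ^ 2 := by rw [pow_succ, pow_mul]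
    have hz2 : z ^ 2 ^ (i + 1 + 1) = ((z ^ 2 ^ i) ^ 2) ^ 2 := by rw [pow_succ, pow_mul, hz1]
    have hx2 : x ^ 2 ^ (i + 1 + 1) = ((x ^ 2 ^ i) ^ 2) ^ 2 := by rw [pow_succ, pow_mul, hx1]
    rw [hz1, hx1] at ih
    rw [hz2, hx2, Nat.sq_sub_sq]
    have := card_primeFactors_lt_of_sq hs hts hco
    omega

/-- On a power-ends triple `(x^(2^(k+1)), b, z^(2^(k+1)))`: `ω(abc) ≥ k`. [folklore] -/
theorem le_card_primeFactors_of_powEnds {k a b c x z : ℕ} (h : IsABCTriple a b c)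
    (hx : a = x ^ 2 ^ (k + 1)) (hz : c = z ^ 2 ^ (k + 1)) :
    k ≤ (a * b * c).primeFactors.card := by
  obtain ⟨ha, hb, habc, hcop⟩ := h
  have hn : 2 ^ (k + 1) ≠ 0 := by positivity
  have hx0 : 0 < x := by
    rcases Nat.eq_zero_or_pos x with h0 | h0
    · rw [h0, zero_pow hn] at hx; omega
    · exact h0
  have hxz : x < z := by
    have : x ^ 2 ^ (k + 1) < z ^ 2 ^ (k + 1) := by rw [← hx, ← hz]; omega
    exact lt_of_pow_lt_pow_left₀ _ (Nat.zero_le _) this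
  have hcopxz : Nat.Coprime x z := by
    have hac : Nat.Coprime a c := by
      rw [← habc, Nat.Coprime, Nat.gcd_self_add_right]; exact hcop
    rw [hx, hz] at hac
    exact (Nat.coprime_pow_left_iff (Nat.pos_of_ne_zero hn) _ _).mp
      ((Nat.coprime_pow_right_iff (Nat.pos_of_ne_zero hn) _ _).mp hac)
  have hb' : b = z ^ 2 ^ (k + 1) - x ^ 2 ^ (k + 1) := by omega
  have hc0 : 0 < c := by omega
  have hsub : b.primeFactors ⊆ (a * b * c).primeFactors :=
    Nat.primeFactors_mono ⟨a * c, by ring⟩ (by positivity)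
  calc k ≤ (z ^ 2 ^ (k + 1) - x ^ 2 ^ (k + 1)).primeFactors.card :=
        le_card_primeFactors_pow_sub_pow hx0 hxz hcopxz k
    _ = b.primeFactors.card := by rw [hb']
    _ ≤ (a * b * c).primeFactors.card := Finset.card_le_card hsub

/-- `M ≤ vⁿ − uⁿ` for `n ≥ 2`, `M ≤ u < v`. [folklore] -/
theorem le_pow_sub_pow {u v n M : ℕ} (hn : 2 ≤ n) (hMu : M ≤ u) (huv : u < v) :
    M ≤ v ^ n - u ^ n := by
  obtain ⟨m, rfl⟩ : ∃ m, n = m + 2 := ⟨n - 2, by omega⟩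
  have hP : v ≤ v ^ (m + 1) := Nat.le_self_pow (by omega) v
  have h1 : u ^ (m + 2) ≤ u * v ^ (m + 1) := by
    rw [pow_succ']
    exact Nat.mul_le_mul_left u (Nat.pow_le_pow_left huv.le (m + 1))
  have h2 : u * v ^ (m + 1) + v ^ (m + 1) ≤ v ^ (m + 2) := by
    calc u * v ^ (m + 1) + v ^ (m + 1) = (u + 1) * v ^ (m + 1) := by ring
      _ ≤ v * v ^ (m + 1) := Nat.mul_le_mul_right _ huv
      _ = v ^ (m + 2) := by ring
  omega

/-! ### Transport restricted to `u ≥ M` -/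

/-- Evaluation at `(a, c)` of a radical lower bound available for `u ≥ M` only. [folklore] -/
theorem abc_eval_from (k M : ℕ) {μ κ : ℝ}
    (H : ∀ u v : ℕ, M ≤ u → 0 < u → u < v → Nat.Coprime u v →
      κ * (v : ℝ) ^ μ ≤ ((radical (u * v * (v ^ (k + 1) - u ^ (k + 1))) : ℕ) : ℝ))
    {a b c : ℕ} (h : IsABCTriple a b c) (hM : M ≤ a) :
    κ * (c : ℝ) ^ μ ≤ ((k : ℝ) + 1) * (c : ℝ) ^ k * ((rad a b c : ℕ) : ℝ) := by
  obtain ⟨ha, hb, habc, hcop⟩ := h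
  have hac : a < c := by omega
  have hcopac : Nat.Coprime a c := by
    rw [← habc, Nat.Coprime, Nat.gcd_self_add_right]; exact hcop
  exact (H a c hM ha hac hcopac).trans (radical_form_le a b c k ⟨ha, hb, habc, hcop⟩)

/-- From `κ v^{k+θ} ≤ rad(u v (v^{k+1} − u^{k+1}))` for `M ≤ u` to `c ≤ C · rad(abc)^{1/θ}` on the
abc triples with `M ≤ a`. [folklore] -/
theorem le_of_radLowerBoundFrom (k M : ℕ) {θ κ : ℝ} (hθ : 0 < θ) (hκ : 0 < κ)
    (H : ∀ u v : ℕ, M ≤ u → 0 < u → u < v → Nat.Coprime u v →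
      κ * (v : ℝ) ^ ((k : ℝ) + θ) ≤ ((radical (u * v * (v ^ (k + 1) - u ^ (k + 1))) : ℕ) : ℝ))
    {a b c : ℕ} (h : IsABCTriple a b c) (hM : M ≤ a) :
    (c : ℝ) ≤ (((k : ℝ) + 1) / κ) ^ (1 / θ) * ((rad a b c : ℕ) : ℝ) ^ (1 / θ) := by
  have key := abc_eval_from k M H h hM
  have hR := rad_cast_pos h
  obtain ⟨ha, hb, habc, -⟩ := h
  have hc0 : (0 : ℝ) < c := by exact_mod_cast (show 0 < c by omega)
  set R : ℝ := ((rad a b c : ℕ) : ℝ) with hRdef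
  have hsplit : (c : ℝ) ^ ((k : ℝ) + θ) = (c : ℝ) ^ k * (c : ℝ) ^ θ := by
    rw [Real.rpow_add hc0, Real.rpow_natCast]
  rw [hsplit] at key
  have hck : (0 : ℝ) < (c : ℝ) ^ k := by positivity
  have key2 : κ * (c : ℝ) ^ θ ≤ ((k : ℝ) + 1) * R := by
    have : (c : ℝ) ^ k * (κ * (c : ℝ) ^ θ) ≤ (c : ℝ) ^ k * (((k : ℝ) + 1) * R) := by
      calc (c : ℝ) ^ k * (κ * (c : ℝ) ^ θ) = κ * ((c : ℝ) ^ k * (c : ℝ) ^ θ) := by ring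
        _ ≤ ((k : ℝ) + 1) * (c : ℝ) ^ k * R := key
        _ = (c : ℝ) ^ k * (((k : ℝ) + 1) * R) := by ring
    exact le_of_mul_le_mul_left this hck
  have key3 : (c : ℝ) ^ θ ≤ ((k : ℝ) + 1) / κ * R := by
    rw [div_mul_eq_mul_div, le_div_iff₀ hκ]; linarith [key2]
  have key4 := le_rpow_one_div_of_rpow_le hθ hc0.le key3
  rwa [Real.mul_rpow (by positivity) hR.le] at key4

/-- **A `CycloRad`-type bound for the pairs `u ≥ M` already implies abc** (`n ≥ 1`): evaluate at
`(a, c)` if `a ≥ M`, at `(b, c)` if `b ≥ M`; the triples with `a, b < M` have `c < 2M`. [folklore] -/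
theorem abc_of_cycloRadFrom {n : ℕ} (M : ℕ) (hn : 1 ≤ n)
    (H : ∀ ε : ℝ, 0 < ε → ∃ κ : ℝ, 0 < κ ∧ ∀ u v : ℕ, M ≤ u → 0 < u → u < v → Nat.Coprime u v →
      κ * (v : ℝ) ^ ((n : ℝ) - ε) ≤ ((radical (u * v * (v ^ n - u ^ n)) : ℕ) : ℝ)) : ABC := by
  obtain ⟨k, rfl⟩ : ∃ k, n = k + 1 := ⟨n - 1, by omega⟩
  rw [ABC_iff]
  intro ε hε
  set θ : ℝ := 1 / (1 + ε) with hθdef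
  have hθ0 : 0 < θ := by positivity
  have hθ1 : θ < 1 := by rw [hθdef, div_lt_one (by positivity)]; linarith
  obtain ⟨κ, hκ, Hκ⟩ := H (1 - θ) (by linarith)
  have H' : ∀ u v : ℕ, M ≤ u → 0 < u → u < v → Nat.Coprime u v →
      κ * (v : ℝ) ^ ((k : ℝ) + θ) ≤ ((radical (u * v * (v ^ (k + 1) - u ^ (k + 1))) : ℕ) : ℝ) := by
    intro u v hMu hu huv hc
    have := Hκ u v hMu hu huv hc
    rwa [show ((k + 1 : ℕ) : ℝ) - (1 - θ) = (k : ℝ) + θ by push_cast; ring] at this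
  have hinv : 1 / θ = 1 + ε := by rw [hθdef, one_div_one_div]
  set C : ℝ := (((k : ℝ) + 1) / κ) ^ (1 + ε) with hCdef
  have hC : 0 < C := by positivity
  have hM0 : (0 : ℝ) ≤ M := Nat.cast_nonneg M
  refine ⟨C + 2 * M + 1, by positivity, ?_⟩
  intro a b c h
  have hR := rad_cast_pos h
  have hpow : (0 : ℝ) < ((rad a b c : ℕ) : ℝ) ^ (1 + ε) := Real.rpow_pos_of_pos hR _
  have hRn : 0 < rad a b c := by exact_mod_cast hR
  have hR1' : (1 : ℝ) ≤ ((rad a b c : ℕ) : ℝ) := by exact_mod_cast hRn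
  have hR1 : (1 : ℝ) ≤ ((rad a b c : ℕ) : ℝ) ^ (1 + ε) := Real.one_le_rpow hR1' (by positivity)
  have hlt : C * ((rad a b c : ℕ) : ℝ) ^ (1 + ε) < (C + 2 * M + 1) * ((rad a b c : ℕ) : ℝ) ^ (1 + ε) := by
    have := mul_pos (by positivity : (0 : ℝ) < 2 * M + 1) hpow
    linarith [this]
  rcases le_or_gt M a with hMa | hMa
  · have h1 := le_of_radLowerBoundFrom k M hθ0 hκ H' h hMa
    rw [hinv, ← hCdef] at h1
    exact h1.trans_lt hlt
  · rcases le_or_gt M b with hMb | hMb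
    · have h' : IsABCTriple b a c := by
        obtain ⟨ha, hb, habc, hcop⟩ := h
        exact ⟨hb, ha, by omega, hcop.symm⟩
      have h1 := le_of_radLowerBoundFrom k M hθ0 hκ H' h' hMb
      have hsw : rad b a c = rad a b c := by rw [rad_def, rad_def, mul_comm b a]
      rw [hinv, hsw, ← hCdef] at h1
      exact h1.trans_lt hlt
    · obtain ⟨ha, hb, habc, -⟩ := h
      have hc2 : (c : ℝ) < 2 * M := by exact_mod_cast (show c < 2 * M by omega)
      calc (c : ℝ) < 2 * M := hc2
        _ ≤ (2 * M) * ((rad a b c : ℕ) : ℝ) ^ (1 + ε) := le_mul_of_one_le_right (by positivity) hR1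
        _ ≤ (C + 2 * M + 1) * ((rad a b c : ℕ) : ℝ) ^ (1 + ε) := by
            apply mul_le_mul_of_nonneg_right _ hpow.le; linarith

/-! ### The thresholds -/

/-- abc restricted to `{ω ≥ k, min(a,b) ≥ M, 2^(k+1)-th-power ends}` gives the `CycloRad`-type bound
`κ v^{n−ε} ≤ rad(u v (vⁿ − uⁿ))`, `n = 2^(k+1)`, for all coprime `M ≤ u < v`, `0 < u`: apply it to
`(uⁿ, vⁿ − uⁿ, vⁿ)`. [folklore] -/
theorem cycloRadFrom_of_abcThresholds (k M : ℕ)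
    (H : ∀ ε : ℝ, 0 < ε → ∃ C : ℝ, 0 < C ∧ ∀ a b c : ℕ, IsABCTriple a b c →
      k ≤ (a * b * c).primeFactors.card → M ≤ a → M ≤ b →
      (∃ x : ℕ, a = x ^ 2 ^ (k + 1)) → (∃ z : ℕ, c = z ^ 2 ^ (k + 1)) →
      (c : ℝ) < C * ((rad a b c : ℕ) : ℝ) ^ (1 + ε)) :
    ∀ ε : ℝ, 0 < ε → ∃ κ : ℝ, 0 < κ ∧ ∀ u v : ℕ, M ≤ u → 0 < u → u < v → Nat.Coprime u v →
      κ * (v : ℝ) ^ (((2 ^ (k + 1) : ℕ) : ℝ) - ε)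
        ≤ ((radical (u * v * (v ^ 2 ^ (k + 1) - u ^ 2 ^ (k + 1))) : ℕ) : ℝ) := by
  have hn0 : 2 ^ (k + 1) ≠ 0 := by positivity
  have hn2 : 2 ≤ 2 ^ (k + 1) := by
    calc 2 = 2 ^ 1 := by norm_num
      _ ≤ 2 ^ (k + 1) := Nat.pow_le_pow_right (by norm_num) (by omega)
  intro ε hε
  have hnR : (0 : ℝ) < ((2 ^ (k + 1) : ℕ) : ℝ) := by positivity
  set δ : ℝ := ε / ((2 ^ (k + 1) : ℕ) : ℝ) with hδdef
  have hδ : 0 < δ := by positivity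
  obtain ⟨C, hC, HC⟩ := H δ hδ
  refine ⟨(1 / C) ^ (1 / (1 + δ)), by positivity, ?_⟩
  intro u v hMu hu huv hcop
  have hv : 0 < v := by omega
  have hlt : u ^ 2 ^ (k + 1) < v ^ 2 ^ (k + 1) := Nat.pow_lt_pow_left huv hn0
  have hT : IsABCTriple (u ^ 2 ^ (k + 1)) (v ^ 2 ^ (k + 1) - u ^ 2 ^ (k + 1)) (v ^ 2 ^ (k + 1)) := by
    refine ⟨by positivity, by omega, by omega, ?_⟩
    exact (Nat.coprime_sub_self_right hlt.le).mpr (Nat.Coprime.pow _ _ hcop)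
  have hcard : k ≤ (u ^ 2 ^ (k + 1) * (v ^ 2 ^ (k + 1) - u ^ 2 ^ (k + 1)) * v ^ 2 ^ (k + 1)).primeFactors.card :=
    le_card_primeFactors_of_powEnds hT rfl rfl
  have hMa : M ≤ u ^ 2 ^ (k + 1) := hMu.trans (Nat.le_self_pow hn0 u)
  have hMb : M ≤ v ^ 2 ^ (k + 1) - u ^ 2 ^ (k + 1) := le_pow_sub_pow hn2 hMu huv
  have hH := HC _ _ _ hT hcard hMa hMb ⟨u, rfl⟩ ⟨v, rfl⟩
  have hradeq : rad (u ^ 2 ^ (k + 1)) (v ^ 2 ^ (k + 1) - u ^ 2 ^ (k + 1)) (v ^ 2 ^ (k + 1))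
      = radical (u * v * (v ^ 2 ^ (k + 1) - u ^ 2 ^ (k + 1))) := by
    rw [rad_def]
    exact radical_pow_mul_mul_pow u v _ _ hn0 (by omega) (by omega) (by omega)
  rw [hradeq] at hH
  push_cast at hH
  set n : ℕ := 2 ^ (k + 1) with hndef
  set ρ : ℝ := ((radical (u * v * (v ^ n - u ^ n)) : ℕ) : ℝ) with hρdef
  have hρ0 : 0 ≤ ρ := Nat.cast_nonneg _
  have hvR : (0 : ℝ) < v := by exact_mod_cast hv
  have hv1 : (1 : ℝ) ≤ v := by exact_mod_cast hv
  have hH' : ((v : ℝ) ^ n) < C * ρ ^ (1 + δ) := by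
    have : ((v ^ n : ℕ) : ℝ) = (v : ℝ) ^ n := by push_cast; ring
    simpa [this] using hH
  have h1 : (v : ℝ) ^ n / C < ρ ^ (1 + δ) := by
    rw [div_lt_iff₀ hC]; linarith [hH']
  have h2 : ((v : ℝ) ^ n / C) ^ (1 / (1 + δ)) < ρ := by
    have := Real.rpow_lt_rpow (by positivity) h1 (by positivity : (0 : ℝ) < 1 / (1 + δ))
    rwa [← Real.rpow_mul hρ0, show (1 + δ) * (1 / (1 + δ)) = 1 by field_simp,
      Real.rpow_one] at this
  have h3 : ((v : ℝ) ^ n / C) ^ (1 / (1 + δ))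
      = (1 / C) ^ (1 / (1 + δ)) * (v : ℝ) ^ ((n : ℝ) / (1 + δ)) := by
    rw [div_eq_mul_one_div ((v : ℝ) ^ n) C, mul_comm ((v : ℝ) ^ n),
      Real.mul_rpow (by positivity) (by positivity), ← Real.rpow_natCast,
      ← Real.rpow_mul hvR.le, mul_one_div]
  have hexp : (n : ℝ) - ε ≤ (n : ℝ) / (1 + δ) := by
    rw [le_div_iff₀ (by positivity)]
    have hnd : (n : ℝ) * δ = ε := by rw [hδdef]; field_simp
    nlinarith [mul_pos hε hδ]
  have h4 : (v : ℝ) ^ ((n : ℝ) - ε) ≤ (v : ℝ) ^ ((n : ℝ) / (1 + δ)) :=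
    Real.rpow_le_rpow_of_exponent_le hv1 hexp
  calc (1 / C) ^ (1 / (1 + δ)) * (v : ℝ) ^ ((n : ℝ) - ε)
      ≤ (1 / C) ^ (1 / (1 + δ)) * (v : ℝ) ^ ((n : ℝ) / (1 + δ)) :=
        mul_le_mul_of_nonneg_left h4 (by positivity)
    _ = ((v : ℝ) ^ n / C) ^ (1 / (1 + δ)) := h3.symm
    _ ≤ ρ := h2.le

/-- **Thresholds are free (one direction).**  abc restricted to the triples with `ω(abc) ≥ k`,
`min(a, b) ≥ M` and `2^(k+1)`-th-power ends implies abc. [folklore] -/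
theorem abc_of_abcThresholds (k M : ℕ)
    (H : ∀ ε : ℝ, 0 < ε → ∃ C : ℝ, 0 < C ∧ ∀ a b c : ℕ, IsABCTriple a b c →
      k ≤ (a * b * c).primeFactors.card → M ≤ a → M ≤ b →
      (∃ x : ℕ, a = x ^ 2 ^ (k + 1)) → (∃ z : ℕ, c = z ^ 2 ^ (k + 1)) →
      (c : ℝ) < C * ((rad a b c : ℕ) : ℝ) ^ (1 + ε)) : ABC :=
  abc_of_cycloRadFrom M (Nat.one_le_two_pow) (cycloRadFrom_of_abcThresholds k M H)

/-- **`ABC ⟺ abc on {ω(abc) ≥ k, min(a,b) ≥ M, a = x^(2^(k+1)), c = z^(2^(k+1))}`**, for every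
`k, M`. [folklore] -/
theorem abc_iff_abcThresholds (k M : ℕ) :
    ABC ↔ (∀ ε : ℝ, 0 < ε → ∃ C : ℝ, 0 < C ∧ ∀ a b c : ℕ, IsABCTriple a b c →
      k ≤ (a * b * c).primeFactors.card → M ≤ a → M ≤ b →
      (∃ x : ℕ, a = x ^ 2 ^ (k + 1)) → (∃ z : ℕ, c = z ^ 2 ^ (k + 1)) →
      (c : ℝ) < C * ((rad a b c : ℕ) : ℝ) ^ (1 + ε)) := by
  refine ⟨fun habc ε hε => ?_, abc_of_abcThresholds k M⟩
  rw [ABC_iff] at habc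
  obtain ⟨C, hC, HC⟩ := habc ε hε
  exact ⟨C, hC, fun a b c h _ _ _ _ _ => HC a b c h⟩

/-- **`ABC ⟺ abc on the triples with at least `k` prime factors**, for every `k`: the first open
case `ω(abc) = 3` is not load-bearing. [folklore] -/
theorem abc_iff_abcCardGe (k : ℕ) :
    ABC ↔ (∀ ε : ℝ, 0 < ε → ∃ C : ℝ, 0 < C ∧ ∀ a b c : ℕ, IsABCTriple a b c →
      k ≤ (a * b * c).primeFactors.card →
      (c : ℝ) < C * ((rad a b c : ℕ) : ℝ) ^ (1 + ε)) := by
  refine ⟨fun habc ε hε => ?_, fun H => abc_of_abcThresholds k 0 (fun ε hε => ?_)⟩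
  · rw [ABC_iff] at habc
    obtain ⟨C, hC, HC⟩ := habc ε hε
    exact ⟨C, hC, fun a b c h _ => HC a b c h⟩
  · obtain ⟨C, hC, HC⟩ := H ε hε
    exact ⟨C, hC, fun a b c h hk _ _ _ _ => HC a b c h hk⟩

/-- **`ABC ⟺ abc on the triples with `min(a, b) ≥ M`**, for every `M`: the `a = 1` shapes and
every bounded range of the smaller summand are not load-bearing. [folklore] -/
theorem abc_iff_abcMinGe (M : ℕ) :
    ABC ↔ (∀ ε : ℝ, 0 < ε → ∃ C : ℝ, 0 < C ∧ ∀ a b c : ℕ, IsABCTriple a b c →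
      M ≤ a → M ≤ b →
      (c : ℝ) < C * ((rad a b c : ℕ) : ℝ) ^ (1 + ε)) := by
  refine ⟨fun habc ε hε => ?_, fun H => abc_of_abcThresholds 0 M (fun ε hε => ?_)⟩
  · rw [ABC_iff] at habc
    obtain ⟨C, hC, HC⟩ := habc ε hε
    exact ⟨C, hC, fun a b c h _ _ => HC a b c h⟩
  · obtain ⟨C, hC, HC⟩ := H ε hε
    exact ⟨C, hC, fun a b c h _ ha hb _ _ => HC a b c h ha hb⟩

end Summit.ABC.ABC.Theorems

end
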